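import Mathlib.Topology.Algebra.OpenSubgroup
import Mathlib.Topology.Separation.Profinite
import HarnessLib

/-!
# Compact open subgroups of a locally compact totally disconnected group (van Dantzig's theorem)

Topic `Topology/Algebra`; namespace `Literature.Topology.Algebra`.  THEOREMS ONLY (no definition, no instance, no notation, no
named fact, no `sorry`).  GENERIC topology of groups, reusable.

In a locally compact Hausdorff totally disconnected topological group every neighbourhood of `1` contains a COMPACT OPEN
SUBGROUP (van Dantzig 1936; [BernsteinZelevinsky1976, §1.1] «`ℓ`-groups»: the compact open subgroups form a basis of
neighbourhoods of the identity).  Mathlib proves the compact-group form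
(`IsTopologicalGroup.exist_openSubgroup_sub_clopen_nhds_of_one`: in a COMPACT group every clopen neighbourhood of `1` contains an
open subgroup); its proof uses compactness only through the compactness of the neighbourhood, and we re-run it for a compact open
neighbourhood `W` of `1` in an arbitrary topological group:
* `exists_nhds_one_mul_subset_of_isCompact_isOpen` — for `W` compact open there is `T ∈ 𝓝 1` with `W * T ⊆ W`;
* `exists_mulInvClosureNhd_of_isCompact_isOpen` — the same with `T` open and symmetric (Mathlib's `mulInvClosureNhd`);
* `exists_openSubgroup_subset_of_isCompact_isOpen` — a compact open `W ∋ 1` contains an open subgroup (which is then compact);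
* `exists_isCompact_openSubgroup_subset` — **van Dantzig**: in a locally compact Hausdorff totally disconnected group every
  `U ∈ 𝓝 1` contains a compact open subgroup; `exists_isCompact_isOpen_subgroup` — there is a compact open subgroup.
(Proofs adapted from the cell's kernel-checked `Summits/Ventures/HodgeRepro2/T5VanDantzig.lean`, which a `Literature` file cannot import.)

Consumer (cell `pub/hodgecm-mathlib`, crux H413 `stmt-HodgeConjecture-24833`, line LH4 Shalika pay-down, organ SPAN-e): the compact open subgroup `K₀`
that ★ `Literature.MeasureTheory.Group.exists_forall_apply_eq_const_mul_integral_of_smul_invariant` («COINV-1») takes as input.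
HONEST LABEL: pure topology, count-neutral; HC_CM is proved only modulo the printed citations until rung 0 closes.

## References
* [BernsteinZelevinsky1976] I. N. Bernstein, A. V. Zelevinsky, *Representations of the group GL(n, F) where F is a non-archimedean
  local field*, Russian Math. Surveys 31:3 (1976) 1–68: §1.1 (`ℓ`-spaces and `ℓ`-groups).
* D. van Dantzig, *Zur topologischen Algebra III*, Compositio Math. 3 (1936) 408–426 (recorded, not cited by key).
-/

set_option autoImplicit false

open Set Filter Topology
open scoped Pointwise

namespace Literature.Topology.Algebra

section VanDantzig

variable {G : Type*} [TopologicalSpace G] [Group G] [IsTopologicalGroup G]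

/-- For a compact open `W` there is a neighbourhood `T` of `1` with `W * T ⊆ W` (Mathlib's
`IsTopologicalGroup.exist_mul_closure_nhds` with «`G` compact, `W` clopen» replaced by «`W` compact open»).
[cite: BernsteinZelevinsky1976, §1.1] -/
theorem exists_nhds_one_mul_subset_of_isCompact_isOpen {W : Set G} (hWc : IsCompact W) (hWo : IsOpen W) :
    ∃ T ∈ 𝓝 (1 : G), W * T ⊆ W := by
  apply hWc.induction_on (p := fun S => ∃ T ∈ 𝓝 (1 : G), S * T ⊆ W)
    ⟨Set.univ, by simp only [univ_mem, empty_mul, empty_subset, and_self]⟩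
    (fun _ _ huv ⟨T, hT, hsub⟩ => ⟨T, hT, (mul_subset_mul_right huv).trans hsub⟩)
    fun U V ⟨T₁, hT₁, h₁⟩ ⟨T₂, hT₂, h₂⟩ => ⟨T₁ ∩ T₂, inter_mem hT₁ hT₂, by
      rw [union_mul]
      exact union_subset ((mul_subset_mul_left inter_subset_left).trans h₁)
        ((mul_subset_mul_left inter_subset_right).trans h₂)⟩
  intro x hxW
  have hx1 : (x, 1) ∈ (fun p : G × G => p.1 * p.2) ⁻¹' W := by simp [hxW]
  rcases isOpen_prod_iff.mp (continuous_mul.isOpen_preimage W hWo) x 1 hx1 with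
    ⟨U, V, hUo, hVo, hxU, h1V, hUV⟩
  have hUVW : U * V ⊆ W := mul_subset_iff.mpr fun _ hu _ hv => hUV (mk_mem_prod hu hv)
  exact ⟨U ∩ W, ⟨U, hUo.mem_nhds hxU, W, fun _ h => h, rfl⟩, V, hVo.mem_nhds h1V,
    fun _ h => hUVW ((mul_subset_mul_right inter_subset_left) h)⟩

/-- For a compact open `W`, an open symmetric neighbourhood `T` of `1` with `W * T ⊆ W` (Mathlib's structure
`IsTopologicalGroup.mulInvClosureNhd T W`). [cite: BernsteinZelevinsky1976, §1.1] -/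
theorem exists_mulInvClosureNhd_of_isCompact_isOpen {W : Set G} (hWc : IsCompact W) (hWo : IsOpen W) :
    ∃ T, IsTopologicalGroup.mulInvClosureNhd T W := by
  rcases exists_nhds_one_mul_subset_of_isCompact_isOpen hWc hWo with ⟨S, hS, hSW⟩
  rcases mem_nhds_iff.mp hS with ⟨U, hUS, hUo, h1U⟩
  refine ⟨U ∩ U⁻¹, ?_, ?_, ?_, ?_⟩
  · simp [hUo.mem_nhds h1U, inv_mem_nhds_one]
  · simp [inter_comm]
  · exact hUo.inter hUo.inv
  · exact fun a ha => hSW (mul_subset_mul_left hUS (mul_subset_mul_left inter_subset_left ha))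

/-- **Van Dantzig, local form.**  A compact open neighbourhood `W` of `1` contains an open subgroup (Mathlib's
`exist_openSubgroup_sub_clopen_nhds_of_one` without `CompactSpace G`). [cite: BernsteinZelevinsky1976, §1.1] -/
theorem exists_openSubgroup_subset_of_isCompact_isOpen {W : Set G} (hWc : IsCompact W) (hWo : IsOpen W)
    (h1W : (1 : G) ∈ W) : ∃ H : OpenSubgroup G, (H : Set G) ⊆ W := by
  rcases exists_mulInvClosureNhd_of_isCompact_isOpen hWc hWo with ⟨V, hV⟩
  let S : Subgroup G :=
    { carrier := ⋃ n, V ^ (n + 1)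
      mul_mem' := fun ha hb => by
        rcases mem_iUnion.mp ha with ⟨k, hk⟩
        rcases mem_iUnion.mp hb with ⟨l, hl⟩
        refine mem_iUnion.mpr ⟨k + 1 + l, ?_⟩
        rw [add_assoc, pow_add]
        exact Set.mul_mem_mul hk hl
      one_mem' := mem_iUnion.mpr ⟨0, by simp [mem_of_mem_nhds hV.nhds]⟩
      inv_mem' := fun ha => by
        rcases mem_iUnion.mp ha with ⟨k, hk⟩
        refine mem_iUnion.mpr ⟨k, ?_⟩
        rw [← hV.inv]
        simpa only [inv_pow, Set.mem_inv, inv_inv] using hk }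
  have hSo : IsOpen (⋃ n, V ^ (n + 1)) := by
    refine isOpen_iUnion fun n => ?_
    rw [pow_succ]
    exact hV.isOpen.mul_left
  refine ⟨⟨S, hSo⟩, ?_⟩
  have hmul : ∀ n : ℕ, W * V ^ (n + 1) ⊆ W := by
    intro n
    induction n with
    | zero => simp [hV.mul]
    | succ n ih =>
      rw [pow_succ, ← mul_assoc]
      exact (Set.mul_subset_mul_right ih).trans hV.mul
  have hsub : ∀ n : ℕ, V ^ (n + 1) ⊆ W * V ^ (n + 1) := fun n x hx =>
    Set.mem_mul.mpr ⟨1, h1W, x, hx, one_mul x⟩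
  exact iUnion_subset fun i _ hx => hmul i (hsub i hx)

/-- **Van Dantzig.**  In a locally compact Hausdorff totally disconnected group every neighbourhood of `1` contains a compact open
subgroup. [cite: BernsteinZelevinsky1976, §1.1] -/
theorem exists_isCompact_openSubgroup_subset [LocallyCompactSpace G] [T2Space G] [TotallyDisconnectedSpace G]
    {U : Set G} (hU : U ∈ 𝓝 (1 : G)) :
    ∃ H : OpenSubgroup G, IsCompact (H : Set G) ∧ (H : Set G) ⊆ U := by
  rcases mem_nhds_iff.mp hU with ⟨U', hU'U, hU'o, h1U'⟩
  obtain ⟨K, hKc, h1K, hKU'⟩ := exists_compact_subset hU'o h1U'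
  obtain ⟨s, hs, hs1, hsK⟩ :=
    loc_compact_Haus_tot_disc_of_zero_dim.exists_subset_of_mem_open h1K isOpen_interior
  have hsc : IsCompact s := hKc.of_isClosed_subset hs.1 (hsK.trans interior_subset)
  obtain ⟨H, hHs⟩ := exists_openSubgroup_subset_of_isCompact_isOpen hsc hs.2 hs1
  exact ⟨H, hsc.of_isClosed_subset H.isClosed hHs, hHs.trans ((hsK.trans interior_subset).trans (hKU'.trans hU'U))⟩

/-- In a locally compact Hausdorff totally disconnected group there is a compact open subgroup.
[cite: BernsteinZelevinsky1976, §1.1] -/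
theorem exists_isCompact_isOpen_subgroup [LocallyCompactSpace G] [T2Space G] [TotallyDisconnectedSpace G] :
    ∃ K : Subgroup G, IsOpen (K : Set G) ∧ IsCompact (K : Set G) := by
  obtain ⟨H, hHc, -⟩ := exists_isCompact_openSubgroup_subset (G := G) Filter.univ_mem
  exact ⟨(H : Subgroup G), H.isOpen, hHc⟩

end VanDantzig

end Literature.Topology.Algebra
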